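import Mathlib.RingTheory.Valuation.Integral
import Literature.NumberTheory.EllipticCurves.GeomPointReduction
import Literature.NumberTheory.GaloisRepresentations.IntegralGaloisActionProofs
import Literature.NumberTheory.GaloisRepresentations.ArtinLFunctionDirichletProofs
import HarnessLib

/-!
# The inertia group of the place acts trivially on the reduction `E(ℚ̄) → Ẽ(𝔽̄_p)`

Topic `NumberTheory/EllipticCurves`.  Theorems only (nothing is defined, no named fact).  For an
elliptic curve `E = W/ℚ` in global minimal form and a prime `p` of good reduction, the tree's
reduction map `geomReduction : E(ℚ̄) →+ Ẽ(𝔽̄_p)` (`GeomPointReduction`, along the chosen place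
`placeOver p` of `ℚ̄`) is invariant under the absolute inertia group `I_𝔓 ≤ Γ_ℚ` of the prime
`𝔓 = 𝔪_{placeOver p} ∩ \bar ℤ` of `\bar ℤ` cut out by the place:

  `red (τ • P) = red P` for `τ ∈ I_𝔓`, `P ∈ E(ℚ̄)` (`geomReduction_smul_of_mem_inertia`).

This is the statement "`G` opère sur `Ẽ_p` par l'intermédiaire de l'homomorphisme canonique
`G → G_k` et de l'action naturelle de `G_k` sur `Ẽ(k̄)`" of J.-P. Serre, Invent. Math. 15 (1972),
§1.11, proof of Prop. 11 (so the inertia group, which dies in `G_k`, acts trivially: `χ_Y = 1`),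
i.e. the input `hinv` of the module-theoretic skeleton
`exists_forall_sub_mem_line_of_invariant` (`SerreOpenImageOrdinaryLineProofs`) for the local
hypothesis of `serre_open_image_of_reduction_shape` (`SerreOpenImageOfLocalInputProofs`).

Ingredients (all in the tree): `\bar ℤ ⊆ 𝒪_𝔓 = placeOver p` (valuation rings are integrally
closed, Mathlib `Valuation.Integers.mem_of_integral`); the prime `𝔓` is described by
`x ∈ 𝔓 ↔ x ∈ 𝒪_𝔓.nonunits`, the hypothesis shape of the tree's comparison theorems
`Ideal.decompositionSubgroup_eq_of_valuationSubring_holds` (`D_𝔓 =` stabiliser of the place) and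
`Ideal.exists_mul_eq_of_mem_valuationSubring` (`𝒪_𝔓 = \bar ℤ_𝔓`: `z t = s`, `t ∉ 𝔓`), which
give `τ 𝒪_𝔓 = 𝒪_𝔓` and `τ z ≡ z (mod 𝔪)` on `𝒪_𝔓` for `τ ∈ I_𝔓`; then the coordinates of
`τ • P` and `P` have the same integrality and the same residues (`geomReduction_some_coe`,
`geomReduction_some_of_one_lt`).

## References

* [Serre1972] J.-P. Serre, Invent. Math. 15 (1972) 259–331, §1.11, Prop. 11 (proof).
* [SilvermanAEC2009] J. H. Silverman, *The Arithmetic of Elliptic Curves*, 2nd ed., VII.2,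
  VIII.§1 ("inertia acts trivially on `Ẽ`").
* [SerreLocalFields1979] J.-P. Serre, *Local Fields*, Ch. I §7 Prop. 19–21 (the place and its
  decomposition group).
-/

noncomputable section

open scoped Classical NumberField Pointwise
open IsDedekindDomain Field WeierstrassCurve

namespace Literature.NumberTheory.EllipticCurves

open Literature.NumberTheory.GaloisRepresentations Rat.HeightOneSpectrum

variable (p : ℕ) [Fact p.Prime]

/-! ### The place contains `\bar ℤ`; its prime `𝔓` -/

/-- `\bar ℤ ⊆ 𝒪_𝔓`: algebraic integers lie in every place of `ℚ̄` (valuation rings are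
integrally closed). [folklore] -/
theorem coe_absIntegers_mem_placeOver (x : absIntegers (𝓞 ℚ) ℚ) :
    (x : AlgebraicClosure ℚ) ∈ placeOver p := by
  have hint : IsIntegral ℤ (x : AlgebraicClosure ℚ) := isIntegral_int_of_isIntegral x.2
  have hint' : IsIntegral (placeOver p) (x : AlgebraicClosure ℚ) := hint.tower_top
  have h := (integers_placeOver p).mem_of_integral hint'
  exact (ValuationSubring.valuation_le_one_iff _ _).mp h

/-- **The prime `𝔓 = 𝔪 ∩ \bar ℤ` of the place**: an ideal of `\bar ℤ` whose elements are exactly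
the algebraic integers in the maximal ideal of `𝒪_𝔓` (the hypothesis shape of the tree's
comparison theorems for valuation subrings), lying above the place `v` of `ℚ` at `p`.
[cite: SerreLocalFields1979, Ch. I §7 Prop. 19–21] -/
theorem exists_ideal_placeOver {v : HeightOneSpectrum (𝓞 ℚ)} (hv : (primesEquiv v : ℕ) = p) :
    ∃ 𝔓 : Ideal (absIntegers (𝓞 ℚ) ℚ),
      (∀ x : absIntegers (𝓞 ℚ) ℚ, x ∈ 𝔓 ↔ (x : AlgebraicClosure ℚ) ∈ (placeOver p).nonunits) ∧
      𝔓 ∈ v.primesAbove := by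
  -- the inclusion `\bar ℤ → 𝒪_𝔓` and the contraction of the maximal ideal
  set φ : absIntegers (𝓞 ℚ) ℚ →+* placeOver p :=
    { toFun := fun x ↦ ⟨x, coe_absIntegers_mem_placeOver p x⟩
      map_one' := rfl
      map_mul' := fun _ _ ↦ rfl
      map_zero' := rfl
      map_add' := fun _ _ ↦ rfl } with hφ
  set 𝔓 : Ideal (absIntegers (𝓞 ℚ) ℚ) := (IsLocalRing.maximalIdeal (placeOver p)).comap φ with h𝔓
  have hmem : ∀ x : absIntegers (𝓞 ℚ) ℚ, x ∈ 𝔓 ↔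
      (x : AlgebraicClosure ℚ) ∈ (placeOver p).nonunits := by
    intro x
    rw [h𝔓, Ideal.mem_comap, ValuationSubring.valuation_lt_one_iff,
      ValuationSubring.mem_nonunits_iff]
    rfl
  haveI h𝔓prime : 𝔓.IsPrime := Ideal.comap_isPrime φ _
  refine ⟨𝔓, hmem, h𝔓prime, ⟨?_⟩⟩
  -- `𝔓 ∩ 𝓞 ℚ = v`: both are the maximal ideal of `𝓞 ℚ` containing `p`
  have hpv : ((Rat.HeightOneSpectrum.natGenerator v : ℕ) : 𝓞 ℚ) ∈ v.asIdeal := by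
    have h := (Rat.HeightOneSpectrum.natGenerator_dvd_iff v).mp dvd_rfl
    rwa [← map_natCast (Rat.IsIntegralClosure.intEquiv (𝓞 ℚ)), Ideal.apply_mem_of_equiv_iff] at h
  have hpv' : ((p : ℕ) : 𝓞 ℚ) ∈ v.asIdeal := by rw [← hv]; exact hpv
  have hp𝔓 : ((p : ℕ) : absIntegers (𝓞 ℚ) ℚ) ∈ 𝔓 := by
    rw [hmem, ValuationSubring.mem_nonunits_iff]
    exact_mod_cast valuation_placeOver_natCast_lt_one p
  haveI hvmax : v.asIdeal.IsMaximal := v.isPrime.isMaximal v.ne_bot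
  haveI : (𝔓.under (𝓞 ℚ)).IsPrime := Ideal.IsPrime.under (𝓞 ℚ) 𝔓
  -- `v = (p) ≤ 𝔓 ∩ 𝓞 ℚ`, a proper ideal
  have hle : v.asIdeal ≤ 𝔓.under (𝓞 ℚ) := by
    -- `v.asIdeal` is generated by `p` (`𝓞 ℚ ≅ ℤ` is principal: `span_natGenerator`)
    intro x hx
    have hx' : Rat.IsIntegralClosure.intEquiv (𝓞 ℚ) x ∈
        v.asIdeal.map (Rat.IsIntegralClosure.intEquiv (𝓞 ℚ)) := Ideal.mem_map_of_mem _ hx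
    rw [← Rat.HeightOneSpectrum.span_natGenerator, Ideal.mem_span_singleton] at hx'
    obtain ⟨c, hc⟩ := hx'
    have hxeq : x = ((Rat.HeightOneSpectrum.natGenerator v : ℕ) : 𝓞 ℚ) *
        (Rat.IsIntegralClosure.intEquiv (𝓞 ℚ)).symm c := by
      apply (Rat.IsIntegralClosure.intEquiv (𝓞 ℚ)).injective
      rw [map_mul, map_natCast, RingEquiv.apply_symm_apply, ← hc]
    rw [hxeq, Ideal.under_def, Ideal.mem_comap, map_mul, map_natCast]
    refine 𝔓.mul_mem_right _ ?_
    rw [show Rat.HeightOneSpectrum.natGenerator v = p from hv]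
    exact hp𝔓
  have hne : 𝔓.under (𝓞 ℚ) ≠ ⊤ := Ideal.IsPrime.ne_top inferInstance
  exact (hvmax.eq_of_le hne hle)

/-! ### The inertia group of `𝔓` stabilises the place and acts trivially on its residue field -/

variable {p}

/-- For `τ ∈ I_𝔓` (indeed for `τ` in the decomposition group) the place is stable: `τ 𝒪_𝔓 = 𝒪_𝔓`
(`D_𝔓` is the stabiliser of the place, `Ideal.decompositionSubgroup_eq_of_valuationSubring_holds`).
[cite: SerreLocalFields1979, Ch. I §7 Prop. 19–21] -/
theorem smul_placeOver_eq_of_mem_inertia {𝔓 : Ideal (absIntegers (𝓞 ℚ) ℚ)}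
    (hmem : ∀ x : absIntegers (𝓞 ℚ) ℚ, x ∈ 𝔓 ↔ (x : AlgebraicClosure ℚ) ∈ (placeOver p).nonunits)
    {τ : absoluteGaloisGroup ℚ} (hτ : τ ∈ 𝔓.inertia (absoluteGaloisGroup ℚ)) :
    (absoluteGaloisGroup.toAlgEquiv ℚ τ) • placeOver p = placeOver p := by
  haveI : Algebra.IsAlgebraic ℚ (AlgebraicClosure ℚ) := AlgebraicClosure.isAlgebraic ℚ
  have hD := Ideal.decompositionSubgroup_eq_of_valuationSubring_holds (R := 𝓞 ℚ) (K := ℚ)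
    (L := AlgebraicClosure ℚ) (placeOver p) (fun x ↦ coe_absIntegers_mem_placeOver p x) 𝔓 hmem
  have hτD : τ ∈ 𝔓.decompositionSubgroup (absoluteGaloisGroup ℚ) := 𝔓.inertia_le_stabilizer hτ
  have hτD' : absoluteGaloisGroup.toAlgEquiv ℚ τ ∈ (placeOver p).decompositionSubgroup ℚ := by
    rw [← hD]; exact hτD
  exact hτD'

/-- For `τ ∈ I_𝔓` and `z ∈ 𝒪_𝔓`: `τ z ≡ z (mod 𝔪_𝔓)` — the inertia group acts trivially on the
residue field of the place (`𝒪_𝔓 = ar ℤ_𝔓`: `z t = s` with `t ∉ 𝔓`,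
`Ideal.exists_mul_eq_of_mem_valuationSubring`).
[cite: SerreLocalFields1979, Ch. I §7 Prop. 19–21] -/
theorem valuation_smul_sub_lt_one_of_mem_inertia {𝔓 : Ideal (absIntegers (𝓞 ℚ) ℚ)}
    (hmem : ∀ x : absIntegers (𝓞 ℚ) ℚ, x ∈ 𝔓 ↔ (x : AlgebraicClosure ℚ) ∈ (placeOver p).nonunits)
    {τ : absoluteGaloisGroup ℚ} (hτ : τ ∈ 𝔓.inertia (absoluteGaloisGroup ℚ))
    {z : AlgebraicClosure ℚ} (hz : z ∈ placeOver p) :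
    (placeOver p).valuation (τ • z - z) < 1 := by
  haveI : Algebra.IsAlgebraic ℚ (AlgebraicClosure ℚ) := AlgebraicClosure.isAlgebraic ℚ
  set w := (placeOver p).valuation with hw
  obtain ⟨s, t, ht, hzt⟩ := Ideal.exists_mul_eq_of_mem_valuationSubring (R := 𝓞 ℚ) (K := ℚ)
    (placeOver p) 𝔓 hmem hz
  have hτD : τ • 𝔓 = 𝔓 := 𝔓.inertia_le_stabilizer hτ
  -- valuations of `s, t, τ s - s, τ t - t, τ t`
  have hs1 : w s ≤ 1 := (ValuationSubring.valuation_le_one_iff _ _).mpr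
    (coe_absIntegers_mem_placeOver p s)
  have ht1 : w t = 1 := by
    have h := ht
    rw [hmem, ValuationSubring.mem_nonunits_iff, not_lt] at h
    exact le_antisymm ((ValuationSubring.valuation_le_one_iff _ _).mpr
      (coe_absIntegers_mem_placeOver p t)) h
  have hτt : τ • t ∉ 𝔓 := by rwa [← hτD, Ideal.smul_mem_pointwise_smul_iff]
  have hτt1 : w (τ • (t : AlgebraicClosure ℚ)) = 1 := by
    have h := hτt
    rw [hmem, ValuationSubring.mem_nonunits_iff, not_lt, integralClosure.coe_smul] at h
    exact le_antisymm ((ValuationSubring.valuation_le_one_iff _ _).mpr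
      (coe_absIntegers_mem_placeOver p (τ • t))) h
  have hds : w (τ • (s : AlgebraicClosure ℚ) - s) < 1 := by
    have h := (hmem _).mp (hτ s)
    rwa [ValuationSubring.mem_nonunits_iff, AddSubgroupClass.coe_sub, integralClosure.coe_smul] at h
  have hdt : w (τ • (t : AlgebraicClosure ℚ) - t) < 1 := by
    have h := (hmem _).mp (hτ t)
    rwa [ValuationSubring.mem_nonunits_iff, AddSubgroupClass.coe_sub, integralClosure.coe_smul] at h
  -- `τ z - z = ((τ s - s) t - s (τ t - t)) / (τ t · t)`
  have ht0 : (t : AlgebraicClosure ℚ) ≠ 0 := by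
    intro h0; rw [h0, map_zero] at ht1; exact zero_ne_one ht1
  have hτt0 : τ • (t : AlgebraicClosure ℚ) ≠ 0 := by
    intro h0; rw [h0, map_zero] at hτt1; exact zero_ne_one hτt1
  have hz' : z = (s : AlgebraicClosure ℚ) / t := by rw [eq_div_iff ht0, hzt]
  set S : AlgebraicClosure ℚ := (s : AlgebraicClosure ℚ) with hS
  set T : AlgebraicClosure ℚ := (t : AlgebraicClosure ℚ) with hT
  have hτz : τ • z = (τ • S) / (τ • T) := by
    rw [hz', absoluteGaloisGroup.smul_def, absoluteGaloisGroup.smul_def,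
      absoluteGaloisGroup.smul_def, map_div₀]
  have hnum : w ((τ • S - S) * T + -(S * (τ • T - T))) < 1 := by
    refine Valuation.map_add_lt _ ?_ ?_
    · rw [map_mul, ht1, mul_one]; exact hds
    · rw [Valuation.map_neg, map_mul]
      calc w S * w (τ • T - T) ≤ 1 * w (τ • T - T) := by gcongr
        _ < 1 := by rw [one_mul]; exact hdt
  have hcalc : τ • z - z = ((τ • S - S) * T + -(S * (τ • T - T))) / (τ • T * T) := by
    rw [hτz, hz', div_sub_div _ _ hτt0 ht0]
    congr 1
    ring
  rw [hcalc, map_div₀, map_mul, hτt1, ht1, mul_one, div_one]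
  exact hnum

/-! ### Inertia acts trivially on the reduction -/

/-- **The inertia group `I_𝔓` acts trivially on `Ẽ(𝔽̄_p)` through the reduction map**
(Serre 1972, §1.11, proof of Prop. 11: "`G` opère sur `Ẽ_p` par l'intermédiaire de … `G → G_k`";
Silverman VIII.§1 "inertia acts trivially on `Ẽ`"): for the prime `𝔓` of `\bar ℤ` cut out by
the place `placeOver p`, every `τ ∈ I_𝔓 ≤ Γ_ℚ` and every `P ∈ E(ℚ̄)` satisfy
`red (τ • P) = red P`, where `red = geomReduction hΔ : E(ℚ̄) → Ẽ(𝔽̄_p)`.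
[cite: Serre1972, §1.11, Prop. 11 (proof)] -/
theorem geomReduction_smul_of_mem_inertia {W : WeierstrassCurve ℚ} [W.IsGloballyMinimal]
    [W.IsElliptic] (hΔ : ¬ (p : ℤ) ∣ minimalDiscriminantInt W)
    {𝔓 : Ideal (absIntegers (𝓞 ℚ) ℚ)}
    (hmem : ∀ x : absIntegers (𝓞 ℚ) ℚ, x ∈ 𝔓 ↔ (x : AlgebraicClosure ℚ) ∈ (placeOver p).nonunits)
    {τ : absoluteGaloisGroup ℚ} (hτ : τ ∈ 𝔓.inertia (absoluteGaloisGroup ℚ)) (P : W.geomPoints) :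
    geomReduction hΔ (τ • P) = geomReduction hΔ P := by
  have hstab := smul_placeOver_eq_of_mem_inertia hmem hτ
  have hmemτ : ∀ z : AlgebraicClosure ℚ, τ • z ∈ placeOver p ↔ z ∈ placeOver p := by
    intro z
    conv_lhs => rw [← hstab]
    rw [absoluteGaloisGroup.smul_def]
    exact ValuationSubring.smul_mem_pointwise_smul_iff
  have hv := integers_placeOver p
  rcases P with _ | ⟨x, y, hxy⟩
  · change geomReduction hΔ (τ • (0 : W.geomPoints)) = _
    rw [smul_zero]
    rfl
  · -- `τ • (x, y) = (τ x, τ y)`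
    set φ : AlgebraicClosure ℚ →ₐ[ℚ] AlgebraicClosure ℚ :=
      (absoluteGaloisGroup.toAlgEquiv ℚ τ).toAlgHom with hφ
    have hφinj : Function.Injective φ := (absoluteGaloisGroup.toAlgEquiv ℚ τ).injective
    have hτxy : (W.baseChange (AlgebraicClosure ℚ)).toAffine.Nonsingular (τ • x) (τ • y) :=
      (Affine.baseChange_nonsingular (W := W.toAffine) hφinj x y).mpr hxy
    -- `τ • (x, y) = (τ x, τ y)` definitionally (`WeierstrassCurve.smul_def`, `Point.map_some`)
    change geomReduction hΔ (Affine.Point.some (τ • x) (τ • y) hτxy) =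
      geomReduction hΔ (Affine.Point.some x y hxy)
    by_cases hx : x ∈ placeOver p
    · -- integral point: same residues
      have heq : ((placeModel p W).baseChange (AlgebraicClosure ℚ)).toAffine.Equation x y := by
        rw [placeModel_baseChange]; exact hxy.left
      have hy1 : (placeOver p).valuation y ≤ 1 :=
        v_Y_le_one_of_v_X_le_one (W := placeModel p W) hv heq
          ((ValuationSubring.valuation_le_one_iff _ _).mpr hx)
      have hy : y ∈ placeOver p := (ValuationSubring.valuation_le_one_iff _ _).mp hy1
      set a : placeOver p := ⟨x, hx⟩ with ha
      set b : placeOver p := ⟨y, hy⟩ with hb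
      set a' : placeOver p := ⟨τ • x, (hmemτ x).mpr hx⟩ with ha'
      set b' : placeOver p := ⟨τ • y, (hmemτ y).mpr hy⟩ with hb'
      obtain ⟨h₁, hred₁⟩ := geomReduction_some_coe hΔ a b hxy
      obtain ⟨h₂, hred₂⟩ := geomReduction_some_coe hΔ a' b' hτxy
      have hres : ∀ c c' : placeOver p,
          (placeOver p).valuation ((c' : AlgebraicClosure ℚ) - c) < 1 →
          placeResidueMap p c' = placeResidueMap p c := by
        intro c c' hcc'
        rw [← sub_eq_zero, ← map_sub, placeResidueMap_eq_zero_iff]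
        exact hcc'
      have hra : placeResidueMap p a' = placeResidueMap p a :=
        hres a a' (valuation_smul_sub_lt_one_of_mem_inertia hmem hτ hx)
      have hrb : placeResidueMap p b' = placeResidueMap p b :=
        hres b b' (valuation_smul_sub_lt_one_of_mem_inertia hmem hτ hy)
      change geomReduction hΔ (Affine.Point.some (a' : AlgebraicClosure ℚ) b' hτxy) =
        geomReduction hΔ (Affine.Point.some (a : AlgebraicClosure ℚ) b hxy)
      rw [hred₁, hred₂]
      exact point_some_congr hra hrb
    · -- `x ∉ 𝒪`: both reduce to `Õ`
      have hx' : 1 < (placeOver p).valuation x := by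
        rw [← not_le, ValuationSubring.valuation_le_one_iff]; exact hx
      have hτx' : 1 < (placeOver p).valuation (τ • x) := by
        rw [← not_le, ValuationSubring.valuation_le_one_iff, hmemτ]; exact hx
      rw [geomReduction_some_of_one_lt hΔ hτxy hτx', geomReduction_some_of_one_lt hΔ hxy hx']

end Literature.NumberTheory.EllipticCurves
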